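import Summits.AtomisticToContinuum.HydrodynamicLimit.Theorems.AntiMazurCoboundariesCorrectorPressureDecayKiferWall
import Summits.AtomisticToContinuum.HydrodynamicLimit.Theorems.AntiMazurCoboundariesCorrectorPressureDecayTangentBiasHolds
import Summits.AtomisticToContinuum.HydrodynamicLimit.Theorems.AntiMazurCoboundariesCorrectorPressureDecayTangentTightnessClosed
import Summits.AtomisticToContinuum.HydrodynamicLimit.Theorems.AntiMazurCoboundariesCorrectorPressureDecayKiferEntropyBoundGibbsAffinity
import Summits.AtomisticToContinuum.HydrodynamicLimit.Theorems.AntiMazurCoboundariesCorrectorPressureDecayKiferCanonicalLocalLimitExists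
import Summits.AtomisticToContinuum.HydrodynamicLimit.Theorems.AntiMazurCoboundariesCorrectorPressureDecayKiferWallLocalLimit
import Summits.AtomisticToContinuum.HydrodynamicLimit.Theorems.AntiMazurCoboundariesCorrectorPressureDecayKiferEntropyBoundAffinity

/-!
# Skeleton v12 of line `FirstLemma` (idea `kifer-compactification`) — crux stmt-AtomisticToContinuum-14135
`AntiMazurCoboundaries.CorrectorPressureDecay` ("X"); MERGED registry of the two live leads (c8's v11 mainline + c7's local-limit route),
registered by c7 (COORDINATION-lead-c7.md 12:30Z entry): BOTH routes' stubs are registered so that neither seat's `--supports` landings bounce.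

c7 additions over c8's v11: the recorded alternative below now runs on REGISTERED stubs `stub_tangentEntropyBoundUniform` (Gibbs-free unit-weight
bound w.r.t. the canonical local limit; reduced by c7's workers to `CellEntropyInequality` and further to the Q-free
`CanonicalBlockMultiInformation`, files rc0 pending landing) and `stub_localLimitWall : EntropicBoltzmannPropertyWrt IsCanonicalLocalLimitRef`
(the wall in local-limit form, implied by the mainline wall GIVEN (E2): `localLimitWall_of_gibbsWall`). c8's v11 text follows.

WAVE 1 (lead c8, six workers; all landed `--supports stmt-AtomisticToContinuum-14135`, axioms standard):
* the COMPACTNESS HALF (E1) of Georgii's equivalence of ensembles is now a THEOREM: `stub_canonicalBlowUpIntensity` p155148,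
  `stub_intensity_of_laplaceLimit` p155470 (corrected: `c ≠ ⊤`), `stub_setwiseWindowLimit_of_domination` p156579 (+ p156080 p156152),
  `stub_canonicalBlowUpWindowDomination` (…KiferCanonicalBlowUpDomination, + Core p156401), assembled in
  …KiferCanonicalLocalLimitExists.lean: `stub_canonicalLocalLimitExists`, `canonicalBlowUpLocallyCompact_holds : CanonicalBlowUpLocallyCompact`,
  `georgii1995_hardSphereCanonicalLocalLimit_of_isGibbs : CanonicalLocalLimitIsGibbs → Georgii1995_hardSphereCanonicalLocalLimit`;
* (E2) audited TRUE, irreducibly cited (Georgii 1995 Thms 3.3–3.4: the single activity is the variational content); the DLR class is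
  closed under setwise local limits (`isHardSphereGibbs_of_tendsto_windowLaw`, p155923);
* the uniform entropy bound audited TRUE and SHARP; block superadditivity of KL for product references landed (p155992); RESHAPE to the
  GIBBS-REFERENCE form `TangentEntropyBoundUniformGibbs` (…KiferEntropyBoundGibbs p156772, affinity reduction …GibbsAffinity): the
  reference's DLR structure and density are hypotheses (free at the call site), so the residual debt is the finite-`N` cell inequality
  against the FREE grand-canonical block reference + the cost of the constant `1` (boundary pressure bound; Legendre identity
  [Ruelle 1969 Thms 3.4.4–3.4.6, named fact]; density series of dilute Gibbs states [Ruelle 1969 Thm 4.2.3, named fact]);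
* the wall with respect to an ABSTRACT reference class and the alternative composition at the CANONICAL LOCAL LIMITS
  (…KiferWallRefClass p155655, …KiferWallLocalLimit p156257): `correctorPressureDecay_of_localLimitWall : TangentTightness → TangentBias →
  CanonicalBlowUpLocallyCompact → TangentEntropyBoundLocal → EntropicBoltzmannPropertyWrt IsCanonicalLocalLimitRef → X` — (E2) OFF that
  path, and GIVEN (E2) the local-limit wall is implied by the registered wall.

THE LINE MODULO (mainline, this file): (E2) `stub_canonicalLocalLimitIsGibbs` [cited], the Gibbs-reference unit-weight entropy bound
`stub_tangentEntropyBoundUniformGibbs` [posited, decomposition recorded in LEAD-c8.md], and THE WALL `stub_entropicBoltzmannTangent`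
[lead-held, open problem in kind]. Recorded alternative (`CorrectorPressureDecay_of_localLimitWall'` below): (E1) PROVED ∧ the Gibbs-free
local-limit entropy bound ∧ the LOCAL-LIMIT wall.
-/

noncomputable section

open MeasureTheory ProbabilityTheory Set Filter Topology InformationTheory
open scoped ENNReal NNReal

namespace Summit.AtomisticToContinuum.HydrodynamicLimit.Theorems.KiferCompactification

open Literature.MathematicalPhysics.KineticTheory (T3 V3 hsDiameter localGibbsLaw blowUpPoint blowUp
  Georgii1995_hardSphereCanonicalLocalLimit)
open Literature.MathematicalPhysics.KineticTheory.PointProcess (laplaceFunctional specificRelEntropy windowLaw)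
open Literature.Analysis.FluidPDE (HardSphereFlow Config IsHardCore IsHardSphereGibbs IsTranslationInvariant)
open Literature.Analysis.FunctionSpaces (PointConfig)
open Summit.AtomisticToContinuum.HydrodynamicLimit.Theses.AntiMazurCoboundaries (CorrectorPressureDecay)

/-! ## Registered stubs -/

/-- (E2) CITED DEBT (registered stub; Georgii 1995 Thm 3.4 with Thm 3.3 / Remark 3.6): translation-invariant, a.s. unit-hard-core
probability local limits of density `σ³` of the x-averaged blown-up canonical hard-sphere laws are DLR Gibbs states
`IsHardSphereGibbs 1 z θ⁻¹ u₀` for some activity `z > 0`. -/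
theorem stub_canonicalLocalLimitIsGibbs : CanonicalLocalLimitIsGibbs := by
  sorry

/-- POSITED ENTROPY STATEMENT, GIBBS-REFERENCE FORM (registered stub): the unit-weight local-limit LSC entropy bound with the
reference known to be a translation-invariant DLR Gibbs state of density `σ³` (OVY 1993 L4.2 type; decomposition in LEAD-c8.md). -/
theorem stub_tangentEntropyBoundUniformGibbs : TangentEntropyBoundUniformGibbs := by
  sorry

/-- THE WALL (registered stub): the Entropic Boltzmann Property for tangent states, `ℝ≥0∞` form. -/
theorem stub_entropicBoltzmannTangent : EntropicBoltzmannPropertyTangent := by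
  sorry

/-! ## Composition (mainline: Georgii path) -/

/-- Georgii's named fact from the PROVED compactness half and the cited identification (E2). -/
theorem georgiiCanonicalLocalLimit_of_stubs : Georgii1995_hardSphereCanonicalLocalLimit :=
  georgii1995_hardSphereCanonicalLocalLimit_of_isGibbs stub_canonicalLocalLimitIsGibbs

/-- The entropy input of the assembly from Georgii's fact and the Gibbs-reference unit-weight bound (affinity reduction and
low-density glue landed: …KiferEntropyBoundGibbsAffinity / …KiferEntropyBoundGibbs). -/
theorem tangentEntropyLowDensity_of_stubs : TangentEntropyLowDensity :=
  tangentEntropyLowDensity_of_uniformGibbs georgiiCanonicalLocalLimit_of_stubs stub_tangentEntropyBoundUniformGibbs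

/-- **The line closes the crux modulo (E2), the Gibbs-reference uniform entropy bound and the wall**: `CorrectorPressureDecay`
BY NAME through the landed `correctorPressureDecay_of_tangentLaw` (p139810). -/
theorem CorrectorPressureDecay_of : CorrectorPressureDecay :=
  correctorPressureDecay_of_tangentLaw stub_tangentTightness stub_tangentBias tangentEntropyLowDensity_of_stubs
    stub_entropicBoltzmannTangent

/-! ## Recorded alternative: the local-limit wall (E2 off the path; Gibbs-free entropy bound) -/

/-- THE CRUX FROM THE LOCAL-LIMIT WALL (composition landed as `correctorPressureDecay_of_localLimitWall`, p156257): with (E1) now a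
THEOREM, it needs the Gibbs-free local-limit entropy bound `TangentEntropyBoundLocal` and the wall with respect to the canonical
local limits — both taken as hypotheses here (neither is a registered stub of the mainline). -/
theorem CorrectorPressureDecay_of_localLimitWall' (hL : TangentEntropyBoundLocal)
    (hW : EntropicBoltzmannPropertyWrt IsCanonicalLocalLimitRef) : CorrectorPressureDecay :=
  correctorPressureDecay_of_localLimitWall stub_tangentTightness stub_tangentBias canonicalBlowUpLocallyCompact_holds hL hW

/-! ## c7's route on REGISTERED stubs: Gibbs-free unit-weight entropy bound + local-limit wall (E2 off the path) -/

/-- POSITED ENTROPY STATEMENT, GIBBS-FREE FORM (registered stub, c7's route): the unit-weight local-limit LSC entropy bound w.r.t. the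
canonical local limit itself (def in …KiferEntropyBoundAffinity.lean); reduced by c7's workers to `CellEntropyInequality` and further to the
Q-free Rényi multi-information bound `CanonicalBlockMultiInformation` for the canonical hard-sphere torus law (files rc0, landing pending). -/
theorem stub_tangentEntropyBoundUniform : TangentEntropyBoundUniform := by
  sorry

/-- THE WALL IN LOCAL-LIMIT FORM (registered stub, c7's route; C⁺): the Entropic Boltzmann Property for tangent states with the canonical
local limits `IsCanonicalLocalLimitRef σ a θ u₀` as references (…KiferWallRefClass / …KiferWallLocalLimit); weaker than the mainline wall
GIVEN (E2) (`localLimitWall_of_gibbsWall`). Lead-held; open problem in kind. -/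
theorem stub_localLimitWall : EntropicBoltzmannPropertyWrt IsCanonicalLocalLimitRef := by
  sorry

/-- The local-limit wall from the mainline (Gibbs-form) wall and (E2) (c8's `entropicBoltzmannPropertyWrt_localLimit_of_tangent`, p156257). -/
theorem localLimitWall_of_gibbsWall (hW : EntropicBoltzmannPropertyTangent) (hE2 : CanonicalLocalLimitIsGibbs) :
    EntropicBoltzmannPropertyWrt IsCanonicalLocalLimitRef :=
  entropicBoltzmannPropertyWrt_localLimit_of_tangent hW hE2

/-- The Gibbs-free local-limit entropy bound from the registered unit-weight stub and the two DISCHARGED Kallenberg facts (affinity p144527). -/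
theorem tangentEntropyBoundLocal_of_stub : TangentEntropyBoundLocal :=
  stub_tangentEntropyBoundLocalOfUniform hardCoreLawsVaguelyCompact_holds laplaceFunctionalDeterminesLaw_holds
    stub_tangentEntropyBoundUniform

/-- **c7's route closes the crux modulo TWO registered stubs** (the Gibbs-free unit-weight entropy bound and the local-limit wall), with
`TangentTightness`, `TangentBias` and (E1) THEOREMS and (E2) off the path. -/
theorem CorrectorPressureDecay_of_localLimit : CorrectorPressureDecay :=
  correctorPressureDecay_of_localLimitWall stub_tangentTightness stub_tangentBias canonicalBlowUpLocallyCompact_holds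
    tangentEntropyBoundLocal_of_stub stub_localLimitWall

end Summit.AtomisticToContinuum.HydrodynamicLimit.Theorems.KiferCompactification

end
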